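/-
Copyright (c) 2026 the pub-hodgecm-mathlib formalisation cell (harness21).  Prover seat hodgecm-mathlib-LH4-p04 (g7), req620 Track A «(D-RAM) FOUR-FRAME» squad
(STAGE-1b, heir LEAD F0P3a-plan (g20∕g21) «row T₊ DERIVED»; dealer∕pen LH4-plan (g13) WORD #52∕#53 D-1b; row-(2) lead LH4-p07; (H-lev) LH4-p06 (g6) letter (hG₂)), 2026-09-04.
-/
import Summits.HodgeConjecture.HodgeConjecture.Theorems.F0P3cDyRamLevelsTypeTwoLiterals        -- ★ p859549 (this seat): (C2-lev-lit) the κ-orbital integral of `𝟙_{K_{a,b}}` in the two literal shapes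
import Summits.HodgeConjecture.HodgeConjecture.Theorems.F0P3cDyRamFixedPointLawTypeTwoReduction  -- ★ p856286 (LH4-p06 (g3)): the unit road's (ρ2b′) composition; brings ★ p856257 scalar `τ·D = (β,θ)_v q^{−m}`, ★ p856225 bridge, ★ DEFS `hFamily`
import Summits.HodgeConjecture.HodgeConjecture.Theorems.F0P3cDyRamRowThreeReduction              -- ★ (LH4-p06 (g2)): `measureReal_support_hFamily_ne_zero` (`ν_s ≠ 0`)
import HarnessLib

/-!
# Crux `H413`, line LH4 «(D-RAM) FOUR-FRAME» — STAGE-1b, row (2): brick (C2-lev-X) «THE TYPE-(2) ROW OF A LEVEL PIECE IN X-CURRENCY FROM ONE TWO-LITERAL CENSUS LAW» —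
# LH4-p06 (g6)'s letter (hG₂) of `stub_hside_levLo∕levHi` ⟸ `(β,θ)_v·q_v^{−m}·νG₃(K)·(cnt_{a,b}(ι_w t_h) − cnt_{a,b}(ι_w t_a)) = (cA∕2)·NV + cB∕2`

Cell `hodgecm-mathlib` (D-0151), FLOOR 0, crux item H413 = `stmt-HodgeConjecture-24833`, route of record `HCCMUnconditional`; squad F0∕P3c∕LH4; lane
`--supports stmt-HodgeConjecture-24833 --as helper` (count-neutral; pays NO tier-0 row).  THEOREMS ONLY (no `def`, no instance, no notation, no `sorry`; one statement budget).
`hLaw` is a HYPOTHESIS (the producers' census law, F0P3-p01 (g35)'s TEMPLATE on the type-(2) population) — nothing asserted.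

WHY.  D-1b (dealer g13 WORD #52∕#53) cuts `stub_hside_levLo∕levHi := ★ hSideLevels_hFamily_of_rows … ‹∃ cA cB N₁, hA ∧ hG₂ ∧ hnum›` (LH4-p06 (g6) ★); the ROW-(2) letter
**(hG₂)** is ★ (V6) p859279's `hG` for the level piece at `coefAffine(cA, cB)`: near `1`, on the type-(2) population, for every `X` with `Φ^st(γ_H, hFamily s) = ν_s·X + λ_s∕2`,
`Σᶠ_c Δ‴·Φ(c, 𝟙_{K_{a,b}}) = (Σ_s coef_s ν_s)·X + (Σ_s coef_s λ_s)∕2` (`= (cA∕2)·X + cB∕2` since `ν_s ≠ 0` ★).  This file turns (hG₂) into ONE CENSUS LAW in the currency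
of this seat's organs: by ★ p859549 the left side is `τ·D·νG₃(K)·(cnt_{a,b}(ι_w t_h) − cnt_{a,b}(ι_w t_a))` at the two literals of socket (C″); by ★ p856257 the scalar is
`τ·D = (β,θ)_v·q_v^{−m}` at the tokens `(m, β)`; by ★ p856225 and `ν_{s_V} ≠ 0` the H-side `X` IS the vertex count `NV = #Fix_{γ₂}(U₂ ⧸ K_H) + d % 2`.  So:
* HEAD `gSide_levels_typeTwo_X_of_censusLaw (a b) (cA cB) (hLaw) : ‹(hG₂) at (a, b, cA, cB)›` where
  `hLaw : ∃ V ∈ 𝓝 1, ∀ γ_H ∈ V, G-regular → type (2) → ∀ t_h t_a P₁ dg η γ₁ ‹the (C″) literal clauses of ★ p859549›, ∀ m β ‹tokens›,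
  (β,θ)_v·(q_v^m)⁻¹·(νG₃(K).toReal·(cnt_{a,b}(ι_w t_h) − cnt_{a,b}(ι_w t_a))) = (cA∕2)·NV + cB∕2` — the levels twin of the unit road's (ρ2b′-X) socket (:418), with the RHS
  the (H-lev) letter dictates (`q_v = Nat.card (𝓞_{L⁺} ⧸ v)` as in ★ p856257; ★ Prelude `natCard_quot_eq_card_residueField` converts to `q_w`).
The level schedules enter as `a := ℓa (dOfPlace L v w)`, `b := ℓb (dOfPlace L v w)` at the consumer; `cnt_{a,b}` = ★ p858704's token; the two counts are what ★ p859421 ∕ ★ p859485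
turn into order forms (proof of `hLaw` = the producers' (L-lev-2) law: closed forms via LH4-p07's (T5-P-axis) + cone tables, vs the TEMPLATE).
HONEST LABEL.  Count-neutral, LAW-FREE composition; pays no registered stub; `HC_CM` is proved only modulo the 7 printed citations (2 remaining named inputs: hLiu418 =
`stmt-HodgeConjecture-24832`, h413 = `stmt-HodgeConjecture-24833`) until rung 0 closes.
## References
* [Rogawski1990] J. D. Rogawski, *Automorphic Representations of Unitary Groups in Three Variables*, Ann. of Math. Stud. 123 (1990): §4.9 Prop. 4.9.1 (b) p. 55, Lemma 4.9.3 p. 56; §4.3 (4.3.1) p. 43.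
* [LabesseLanglands1979] J.-P. Labesse, R. P. Langlands, *L-indistinguishability for SL(2)*, Canad. J. Math. 31 (1979): §2 (2.1)–(2.2).
* [Kottwitz1988] R. E. Kottwitz, *Tamagawa numbers*, Ann. of Math. 127 (1988): §2.
-/

set_option autoImplicit false

noncomputable section
namespace Summit.HodgeConjecture.HodgeConjecture.Cruxes.H413.F0P3cDyRamLevelsTypeTwoXOfCensusLaw

open MeasureTheory Measure NumberField IsDedekindDomain Topology Filter
open Literature.NumberTheory.Automorphic Literature.NumberTheory.Automorphic.UnitaryGroup Literature.NumberTheory.Automorphic.IntegralReduction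
open Literature.NumberTheory.Rogawski1990 Literature.NumberTheory.GaloisRepresentations
open Literature.NumberTheory.Automorphic.UnitaryThreeFourFrame
open Summit.HodgeConjecture.HodgeConjecture.Cruxes.H413.F0P3cDyRamFourFrameHSideDefs
open Summit.HodgeConjecture.HodgeConjecture.Cruxes.H413.F0P3cDyRamFourFrameHFamilyDefs
open scoped Matrix MatrixGroups Classical Valued WithZero
open Literature.NumberTheory.Automorphic.UnitaryLatticeTree Literature.NumberTheory.Automorphic.HermitianLattice
open Literature.NumberTheory.QuadraticForms
open Summit.HodgeConjecture.HodgeConjecture.Cruxes.H413.F0P3cDyRamFourFramePieces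
open Summit.HodgeConjecture.HodgeConjecture.Cruxes.H413.F0P3cDyRamFourFrameCensusDefs
open Summit.HodgeConjecture.HodgeConjecture.Cruxes.H413.F0P3cDyRamLevelsTypeTwoLiterals
open Summit.HodgeConjecture.HodgeConjecture.Cruxes.H413.F0P3cDyRamRowThreeReduction
open Summit.HodgeConjecture.HodgeConjecture.Cruxes.H413

set_option maxHeartbeats 400000 in
-- budget only: statement-heavy tokens (the (C″) literal clauses of ★ p859549 inside `hLaw` + (V6)'s `hG` letter; default 200000 times out while elaborating the statement).
/-- **(C2-lev-X) THE TYPE-(2) ROW OF THE LEVEL PIECE `𝟙_{K_{a,b}}` IN X-CURRENCY, FROM ONE TWO-LITERAL CENSUS LAW.**  At a wild ramified non-split CM place `w ∣ v` (datum `(d, t_E)`),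
GIVEN the census law `hLaw` — near `1`, for every `G`-regular type-(2) `γ_H`, every pair of literals `t_h, t_a` in socket (C″)'s shapes (κ-signs `+1, −1`) and every tokens
`(m, β)`: `(β,θ)_v·(q_v^m)⁻¹·(νG₃(K).toReal·(cnt_{a,b}(ι_w t_h) − cnt_{a,b}(ι_w t_a))) = (cA∕2)·(#Fix_{γ₂}(U₂ ⧸ K_H) + d % 2) + cB∕2` — THEN (V6)'s `hG` for `F := 𝟙_{K_{a,b}}` at
`coefAffine(cA, cB)` (LH4-p06 (g6)'s letter (hG₂) VERBATIM, `ℓa∕ℓb (dOfPlace L v w) := a∕b`): near `1`, for every `G`-regular type-(2) `γ_H` and every `X` with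
`Φ^st(γ_H, hFamily s) = ν_s·X + λ_s∕2` (`s = 0, 1`), `Σᶠ_c Δ‴(γ_H, out c)·Φ(c, 𝟙_{K_{a,b}}; mG₃) = (Σ_s coefAffine_s·ν_s)·X + (Σ_s coefAffine_s·λ_s)∕2`.
Proof: ★ p859549 (literals + census difference) ∘ ★ p856257 (`τ·D = (β,θ)_v q_v^{−m}` at `t_h`, κ = 1) ∘ `hLaw` ∘ ★ p856225 + ★ `measureReal_support_hFamily_ne_zero` (`X = NV`) ∘ `field_simp`.
[cite: Rogawski1990, §4.9 Prop. 4.9.1 (b) p. 55, Lemma 4.9.3 p. 56; §4.3 (4.3.1) p. 43] [cite: LabesseLanglands1979, §2 (2.1)–(2.2)] [cite: Kottwitz1988, §2] -/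
theorem gSide_levels_typeTwo_X_of_censusLaw (L : Type) [Field L] [NumberField L] [IsCMField L]
    {v : HeightOneSpectrum (𝓞 ↥(maximalRealSubfield L))} (w : UnitaryGroup.PlacesOver L v)
    (hw : IsCMField.complexConj L • w.1 = w.1) (he : v.asIdeal.ramificationIdx' w.1.asIdeal ≠ 1)
    (ϖ : (w.1.adicCompletion L)) (hϖ : Valued.v ϖ = WithZero.exp (-1 : ℤ)) (d tE : ℕ)
    (hD : IsRamifiedQuadraticDatum (galAdicCompletionMap (L := L) (IsCMField.complexConj L) hw) ϖ d tE)
    (μ : HeckeCharacter L) (hμω : ∀ x : ideleGroup ↥(maximalRealSubfield L), μ (AdeleRing.ideleBaseChange ↥(maximalRealSubfield L) L x) = quadraticHeckeCharCM L x)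
    [MeasurableSpace ((UnitaryGroup.cmDatum L 3 (Matrix.of fun i j : Fin 3 => if i.val + j.val + 1 = 3 then (1 : L) else 0)).Local v)] [BorelSpace ((UnitaryGroup.cmDatum L 3 (Matrix.of fun i j : Fin 3 => if i.val + j.val + 1 = 3 then (1 : L) else 0)).Local v)]
    [∀ γ : ((UnitaryGroup.cmDatum L 3 (Matrix.of fun i j : Fin 3 => if i.val + j.val + 1 = 3 then (1 : L) else 0)).Local v), MeasurableSpace (((UnitaryGroup.cmDatum L 3 (Matrix.of fun i j : Fin 3 => if i.val + j.val + 1 = 3 then (1 : L) else 0)).Local v) ⧸ Subgroup.centralizer ({γ} : Set ((UnitaryGroup.cmDatum L 3 (Matrix.of fun i j : Fin 3 => if i.val + j.val + 1 = 3 then (1 : L) else 0)).Local v)))]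
    [∀ γ : ((UnitaryGroup.cmDatum L 3 (Matrix.of fun i j : Fin 3 => if i.val + j.val + 1 = 3 then (1 : L) else 0)).Local v), BorelSpace (((UnitaryGroup.cmDatum L 3 (Matrix.of fun i j : Fin 3 => if i.val + j.val + 1 = 3 then (1 : L) else 0)).Local v) ⧸ Subgroup.centralizer ({γ} : Set ((UnitaryGroup.cmDatum L 3 (Matrix.of fun i j : Fin 3 => if i.val + j.val + 1 = 3 then (1 : L) else 0)).Local v)))]
    (νG₃ : Measure ((UnitaryGroup.cmDatum L 3 (Matrix.of fun i j : Fin 3 => if i.val + j.val + 1 = 3 then (1 : L) else 0)).Local v)) [νG₃.IsHaarMeasure] [νG₃.IsMulRightInvariant]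
    (mG₃ : OrbitalMeasureFamily ((UnitaryGroup.cmDatum L 3 (Matrix.of fun i j : Fin 3 => if i.val + j.val + 1 = 3 then (1 : L) else 0)).Local v))
    (hmG : mG₃.IsCanonical (fun γ => IsRegularElt (γ.val : GL (Fin 3) (UnitaryGroup.LocalRing L v))) νG₃)
    [MeasurableSpace ((UnitaryGroup.cmDatum L 2 (Matrix.of fun i j : Fin 2 => if i.val + j.val + 1 = 2 then (1 : L) else 0)).Local v × (UnitaryGroup.cmDatum L 1 (Matrix.of fun i j : Fin 1 => if i.val + j.val + 1 = 1 then (1 : L) else 0)).Local v)] [BorelSpace ((UnitaryGroup.cmDatum L 2 (Matrix.of fun i j : Fin 2 => if i.val + j.val + 1 = 2 then (1 : L) else 0)).Local v × (UnitaryGroup.cmDatum L 1 (Matrix.of fun i j : Fin 1 => if i.val + j.val + 1 = 1 then (1 : L) else 0)).Local v)]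
    [∀ a' : ((UnitaryGroup.cmDatum L 2 (Matrix.of fun i j : Fin 2 => if i.val + j.val + 1 = 2 then (1 : L) else 0)).Local v × (UnitaryGroup.cmDatum L 1 (Matrix.of fun i j : Fin 1 => if i.val + j.val + 1 = 1 then (1 : L) else 0)).Local v), MeasurableSpace (((UnitaryGroup.cmDatum L 2 (Matrix.of fun i j : Fin 2 => if i.val + j.val + 1 = 2 then (1 : L) else 0)).Local v × (UnitaryGroup.cmDatum L 1 (Matrix.of fun i j : Fin 1 => if i.val + j.val + 1 = 1 then (1 : L) else 0)).Local v) ⧸ Subgroup.centralizer ({a'} : Set ((UnitaryGroup.cmDatum L 2 (Matrix.of fun i j : Fin 2 => if i.val + j.val + 1 = 2 then (1 : L) else 0)).Local v × (UnitaryGroup.cmDatum L 1 (Matrix.of fun i j : Fin 1 => if i.val + j.val + 1 = 1 then (1 : L) else 0)).Local v)))]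
    [∀ a' : ((UnitaryGroup.cmDatum L 2 (Matrix.of fun i j : Fin 2 => if i.val + j.val + 1 = 2 then (1 : L) else 0)).Local v × (UnitaryGroup.cmDatum L 1 (Matrix.of fun i j : Fin 1 => if i.val + j.val + 1 = 1 then (1 : L) else 0)).Local v), BorelSpace (((UnitaryGroup.cmDatum L 2 (Matrix.of fun i j : Fin 2 => if i.val + j.val + 1 = 2 then (1 : L) else 0)).Local v × (UnitaryGroup.cmDatum L 1 (Matrix.of fun i j : Fin 1 => if i.val + j.val + 1 = 1 then (1 : L) else 0)).Local v) ⧸ Subgroup.centralizer ({a'} : Set ((UnitaryGroup.cmDatum L 2 (Matrix.of fun i j : Fin 2 => if i.val + j.val + 1 = 2 then (1 : L) else 0)).Local v × (UnitaryGroup.cmDatum L 1 (Matrix.of fun i j : Fin 1 => if i.val + j.val + 1 = 1 then (1 : L) else 0)).Local v)))]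
    (νH : Measure ((UnitaryGroup.cmDatum L 2 (Matrix.of fun i j : Fin 2 => if i.val + j.val + 1 = 2 then (1 : L) else 0)).Local v × (UnitaryGroup.cmDatum L 1 (Matrix.of fun i j : Fin 1 => if i.val + j.val + 1 = 1 then (1 : L) else 0)).Local v)) [νH.IsHaarMeasure] [νH.IsMulRightInvariant]
    (mH : OrbitalMeasureFamily ((UnitaryGroup.cmDatum L 2 (Matrix.of fun i j : Fin 2 => if i.val + j.val + 1 = 2 then (1 : L) else 0)).Local v × (UnitaryGroup.cmDatum L 1 (Matrix.of fun i j : Fin 1 => if i.val + j.val + 1 = 1 then (1 : L) else 0)).Local v)) (hmH : mH.IsCanonical (IsLocalGRegular L v) νH)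
    (a b : ℕ) (cA cB : ℂ)
    (hLaw : ∃ V ∈ 𝓝 (1 : ((UnitaryGroup.cmDatum L 2 (Matrix.of fun i j : Fin 2 => if i.val + j.val + 1 = 2 then (1 : L) else 0)).Local v × (UnitaryGroup.cmDatum L 1 (Matrix.of fun i j : Fin 1 => if i.val + j.val + 1 = 1 then (1 : L) else 0)).Local v)), ∀ γH ∈ V, IsLocalGRegular L v γH →
      ¬ (∃ x : (w.1.adicCompletion L), (((((γH).1.val : GL (Fin 2) (UnitaryGroup.LocalRing L v)).val.map (Pi.evalRingHom (fun w' : UnitaryGroup.PlacesOver L v => w'.1.adicCompletion L) w))).charpoly).IsRoot x) →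
      ∀ (th ta : ((UnitaryGroup.cmDatum L 3 (Matrix.of fun i j : Fin 3 => if i.val + j.val + 1 = 3 then (1 : L) else 0)).Local v)) (P₁ : GL (Fin 3) (w.1.adicCompletion L)) (dg : Fin 2 → (w.1.adicCompletion L)) (η : (w.1.adicCompletion L)) (γ₁ : GL (Fin 2) (w.1.adicCompletion L)),
        IsLocalNormPair L (Matrix.of fun i j : Fin 3 => if i.val + j.val + 1 = 3 then (1 : L) else 0) v γH th → finKappaAt L v (Matrix.of fun i j : Fin 3 => if i.val + j.val + 1 = 3 then (1 : L) else 0) γH th = 1 → IsLocalNormPair L (Matrix.of fun i j : Fin 3 => if i.val + j.val + 1 = 3 then (1 : L) else 0) v γH ta → finKappaAt L v (Matrix.of fun i j : Fin 3 => if i.val + j.val + 1 = 3 then (1 : L) else 0) γH ta = -1 →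
        ((localNonsplitEquiv (IsCMField.complexConj L) (Matrix.of fun i j : Fin 3 => if i.val + j.val + 1 = 3 then (1 : L) else 0) (IsCMField.complexConj_ne_one L) w hw th : ↥(unitaryGroupOfForm (galAdicCompletionMap (L := L) (IsCMField.complexConj L) hw) (placeForm (Matrix.of fun i j : Fin 3 => if i.val + j.val + 1 = 3 then (1 : L) else 0) w.1))) : GL (Fin 3) (w.1.adicCompletion L)) = endoGL (((localNonsplitEquiv (IsCMField.complexConj L) (Matrix.of fun i j : Fin 2 => if i.val + j.val + 1 = 2 then (1 : L) else 0) (IsCMField.complexConj_ne_one L) w hw γH.1 : ↥(unitaryGroupOfForm (galAdicCompletionMap (L := L) (IsCMField.complexConj L) hw) (placeForm (Matrix.of fun i j : Fin 2 => if i.val + j.val + 1 = 2 then (1 : L) else 0) w.1))) : GL (Fin 2) (w.1.adicCompletion L)), ((localNonsplitEquiv (IsCMField.complexConj L) (Matrix.of fun i j : Fin 1 => if i.val + j.val + 1 = 1 then (1 : L) else 0) (IsCMField.complexConj_ne_one L) w hw γH.2).val : GL (Fin 1) (w.1.adicCompletion L))) →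
        ((localNonsplitEquiv (IsCMField.complexConj L) (Matrix.of fun i j : Fin 3 => if i.val + j.val + 1 = 3 then (1 : L) else 0) (IsCMField.complexConj_ne_one L) w hw ta : ↥(unitaryGroupOfForm (galAdicCompletionMap (L := L) (IsCMField.complexConj L) hw) (placeForm (Matrix.of fun i j : Fin 3 => if i.val + j.val + 1 = 3 then (1 : L) else 0) w.1))) : GL (Fin 3) (w.1.adicCompletion L)) = P₁ * endoGL (γ₁, ((localNonsplitEquiv (IsCMField.complexConj L) (Matrix.of fun i j : Fin 1 => if i.val + j.val + 1 = 1 then (1 : L) else 0) (IsCMField.complexConj_ne_one L) w hw γH.2).val : GL (Fin 1) (w.1.adicCompletion L))) * P₁⁻¹ →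
        formCongr (galAdicCompletionMap (L := L) (IsCMField.complexConj L) hw) P₁ (placeForm (Matrix.of fun i j : Fin 3 => if i.val + j.val + 1 = 3 then (1 : L) else 0) w.1) = (!![(Matrix.diagonal dg) 0 0, 0, (Matrix.diagonal dg) 0 1; 0, η, 0; (Matrix.diagonal dg) 1 0, 0, (Matrix.diagonal dg) 1 1] : Matrix (Fin 3) (Fin 3) (w.1.adicCompletion L)) →
        (∀ i, Valued.v (dg i) = 1) → (∀ i, (galAdicCompletionMap (L := L) (IsCMField.complexConj L) hw) (dg i) = dg i) →
        (galAdicCompletionMap (L := L) (IsCMField.complexConj L) hw) η = η → Valued.v η = 1 → (¬ ∃ t : (w.1.adicCompletion L), t * (galAdicCompletionMap (L := L) (IsCMField.complexConj L) hw) t = η) →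
        γ₁ ∈ unitaryGroupOfForm (galAdicCompletionMap (L := L) (IsCMField.complexConj L) hw) (Matrix.diagonal dg) →
        (γ₁ : Matrix (Fin 2) (Fin 2) (w.1.adicCompletion L)).charpoly = ((((γH).1.val : GL (Fin 2) (UnitaryGroup.LocalRing L v)).val.map (Pi.evalRingHom (fun w' : UnitaryGroup.PlacesOver L v => w'.1.adicCompletion L) w))).charpoly →
        ∀ (m : ℕ) (β : (v.adicCompletion ↥(maximalRealSubfield L))ˣ), Valued.v (((finCharpolyTwo L v γH).eval (finGammaTwo L v γH)) w) = Valued.v ((toPlace v w (HeckeCharacter.uniformizer ↥(maximalRealSubfield L) v : v.adicCompletion ↥(maximalRealSubfield L))) ^ m) → toPlace v w (β : v.adicCompletion ↥(maximalRealSubfield L)) = -(((finCharpolyTwo L v γH).eval (finGammaTwo L v γH)) w * (finGammaTwo L v γH w ^ 2 + ((γH.1.val.val : Matrix (Fin 2) (Fin 2) (UnitaryGroup.LocalRing L v)).map (Pi.evalRingHom (fun w' : UnitaryGroup.PlacesOver L v => w'.1.adicCompletion L) w)).det)) / (2 * finGammaTwo L v γH w ^ 2 * ((γH.1.val.val : Matrix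 (Fin 2) (Fin 2) (UnitaryGroup.LocalRing L v)).map (Pi.evalRingHom (fun w' : UnitaryGroup.PlacesOver L v => w'.1.adicCompletion L) w)).det) →
          (Literature.NumberTheory.QuadraticForms.hilbertSymbol (v.adicCompletion ↥(maximalRealSubfield L)) (β : v.adicCompletion ↥(maximalRealSubfield L)) (algebraMap ↥(maximalRealSubfield L) _ ((cmQuadraticGenerator L : 𝓞 ↥(maximalRealSubfield L)) : ↥(maximalRealSubfield L))) : ℂ) * (((Nat.card (𝓞 ↥(maximalRealSubfield L) ⧸ v.asIdeal) : ℂ) ^ m))⁻¹ *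
            (((νG₃ ((cmLocalIntegralLevel L 3 (Matrix.of fun i j : Fin 3 => if i.val + j.val + 1 = 3 then (1 : L) else 0) v) : Set ((UnitaryGroup.cmDatum L 3 (Matrix.of fun i j : Fin 3 => if i.val + j.val + 1 = 3 then (1 : L) else 0)).Local v))).toReal : ℂ) *
              (({M : Submodule (Valued.integer (w.1.adicCompletion L)) (Fin 3 → w.1.adicCompletion L) |
              IsVertexLattice (galAdicCompletionMap (L := L) (IsCMField.complexConj L) hw) ϖ ((StdForm.antidiagonal 3).over (w.1.adicCompletion L)) 0 M ∧
                mapGL ((localNonsplitEquiv (IsCMField.complexConj L) (Matrix.of fun i j : Fin 3 => if i.val + j.val + 1 = 3 then (1 : L) else 0) (IsCMField.complexConj_ne_one L) w hw th : ↥(unitaryGroupOfForm (galAdicCompletionMap (L := L) (IsCMField.complexConj L) hw) (placeForm (Matrix.of fun i j : Fin 3 => if i.val + j.val + 1 = 3 then (1 : L) else 0) w.1))) : GL (Fin 3) (w.1.adicCompletion L)) M = M ∧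
                (LatticeInLevel ϖ a ((((localNonsplitEquiv (IsCMField.complexConj L) (Matrix.of fun i j : Fin 3 => if i.val + j.val + 1 = 3 then (1 : L) else 0) (IsCMField.complexConj_ne_one L) w hw th : ↥(unitaryGroupOfForm (galAdicCompletionMap (L := L) (IsCMField.complexConj L) hw) (placeForm (Matrix.of fun i j : Fin 3 => if i.val + j.val + 1 = 3 then (1 : L) else 0) w.1))) : GL (Fin 3) (w.1.adicCompletion L)) : Matrix (Fin 3) (Fin 3) (w.1.adicCompletion L)) - 1) M ∧
                  LatticeInLevel ϖ b (((((localNonsplitEquiv (IsCMField.complexConj L) (Matrix.of fun i j : Fin 3 => if i.val + j.val + 1 = 3 then (1 : L) else 0) (IsCMField.complexConj_ne_one L) w hw th : ↥(unitaryGroupOfForm (galAdicCompletionMap (L := L) (IsCMField.complexConj L) hw) (placeForm (Matrix.of fun i j : Fin 3 => if i.val + j.val + 1 = 3 then (1 : L) else 0) w.1))) : GL (Fin 3) (w.1.adicCompletion L)) : Matrix (Fin 3) (Fin 3) (w.1.adicCompletion L)) - 1) *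
                    ((((localNonsplitEquiv (IsCMField.complexConj L) (Matrix.of fun i j : Fin 3 => if i.val + j.val + 1 = 3 then (1 : L) else 0) (IsCMField.complexConj_ne_one L) w hw th : ↥(unitaryGroupOfForm (galAdicCompletionMap (L := L) (IsCMField.complexConj L) hw) (placeForm (Matrix.of fun i j : Fin 3 => if i.val + j.val + 1 = 3 then (1 : L) else 0) w.1))) : GL (Fin 3) (w.1.adicCompletion L)) : Matrix (Fin 3) (Fin 3) (w.1.adicCompletion L)) - 1)) M)}.ncard : ℂ) -
               ({M : Submodule (Valued.integer (w.1.adicCompletion L)) (Fin 3 → w.1.adicCompletion L) |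
              IsVertexLattice (galAdicCompletionMap (L := L) (IsCMField.complexConj L) hw) ϖ ((StdForm.antidiagonal 3).over (w.1.adicCompletion L)) 0 M ∧
                mapGL ((localNonsplitEquiv (IsCMField.complexConj L) (Matrix.of fun i j : Fin 3 => if i.val + j.val + 1 = 3 then (1 : L) else 0) (IsCMField.complexConj_ne_one L) w hw ta : ↥(unitaryGroupOfForm (galAdicCompletionMap (L := L) (IsCMField.complexConj L) hw) (placeForm (Matrix.of fun i j : Fin 3 => if i.val + j.val + 1 = 3 then (1 : L) else 0) w.1))) : GL (Fin 3) (w.1.adicCompletion L)) M = M ∧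
                (LatticeInLevel ϖ a ((((localNonsplitEquiv (IsCMField.complexConj L) (Matrix.of fun i j : Fin 3 => if i.val + j.val + 1 = 3 then (1 : L) else 0) (IsCMField.complexConj_ne_one L) w hw ta : ↥(unitaryGroupOfForm (galAdicCompletionMap (L := L) (IsCMField.complexConj L) hw) (placeForm (Matrix.of fun i j : Fin 3 => if i.val + j.val + 1 = 3 then (1 : L) else 0) w.1))) : GL (Fin 3) (w.1.adicCompletion L)) : Matrix (Fin 3) (Fin 3) (w.1.adicCompletion L)) - 1) M ∧
                  LatticeInLevel ϖ b (((((localNonsplitEquiv (IsCMField.complexConj L) (Matrix.of fun i j : Fin 3 => if i.val + j.val + 1 = 3 then (1 : L) else 0) (IsCMField.complexConj_ne_one L) w hw ta : ↥(unitaryGroupOfForm (galAdicCompletionMap (L := L) (IsCMField.complexConj L) hw) (placeForm (Matrix.of fun i j : Fin 3 => if i.val + j.val + 1 = 3 then (1 : L) else 0) w.1))) : GL (Fin 3) (w.1.adicCompletion L)) : Matrix (Fin 3) (Fin 3) (w.1.adicCompletion L)) - 1) *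
                    ((((localNonsplitEquiv (IsCMField.complexConj L) (Matrix.of fun i j : Fin 3 => if i.val + j.val + 1 = 3 then (1 : L) else 0) (IsCMField.complexConj_ne_one L) w hw ta : ↥(unitaryGroupOfForm (galAdicCompletionMap (L := L) (IsCMField.complexConj L) hw) (placeForm (Matrix.of fun i j : Fin 3 => if i.val + j.val + 1 = 3 then (1 : L) else 0) w.1))) : GL (Fin 3) (w.1.adicCompletion L)) : Matrix (Fin 3) (Fin 3) (w.1.adicCompletion L)) - 1)) M)}.ncard : ℂ))) =
          cA / 2 * ((Nat.card (MulAction.fixedBy (((UnitaryGroup.cmDatum L 2 (Matrix.of fun i j : Fin 2 => if i.val + j.val + 1 = 2 then (1 : L) else 0)).Local v) ⧸ cmLocalIntegralLevel L 2 (Matrix.of fun i j : Fin 2 => if i.val + j.val + 1 = 2 then (1 : L) else 0) v) γH.1) : ℂ) + ((d % 2 : ℕ) : ℂ)) + cB / 2) :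
    ∃ V ∈ 𝓝 (1 : ((UnitaryGroup.cmDatum L 2 (Matrix.of fun i j : Fin 2 => if i.val + j.val + 1 = 2 then (1 : L) else 0)).Local v × (UnitaryGroup.cmDatum L 1 (Matrix.of fun i j : Fin 1 => if i.val + j.val + 1 = 1 then (1 : L) else 0)).Local v)), ∀ γH ∈ V, IsLocalGRegular L v γH →
      ¬ (∃ x : (w.1.adicCompletion L), (((((γH).1.val : GL (Fin 2) (UnitaryGroup.LocalRing L v)).val.map (Pi.evalRingHom (fun w' : UnitaryGroup.PlacesOver L v => w'.1.adicCompletion L) w))).charpoly).IsRoot x) →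
      ∀ X : ℂ, (∀ s : Fin 2, stableOrbitalIntegralRel (IsLocalStablyConjH L v) mH (hFamily L w hw ϖ s) γH = (νH.real (Function.support (hFamily L w hw ϖ s)) : ℂ) * X + (if ((s : Fin 2) : ℕ) = d % 2 then (0 : ℂ) else -2 * (νH.real (Function.support (hFamily L w hw ϖ s)) : ℂ)) / 2) →
        ∑ᶠ c : ConjClasses ((UnitaryGroup.cmDatum L 3 (Matrix.of fun i j : Fin 3 => if i.val + j.val + 1 = 3 then (1 : L) else 0)).Local v), ((finExplicitCollection L (Matrix.of fun i j : Fin 3 => if i.val + j.val + 1 = 3 then (1 : L) else 0) μ (finExplicitDelta_conj_left_all L (Matrix.of fun i j : Fin 3 => if i.val + j.val + 1 = 3 then (1 : L) else 0) μ) (finExplicitDelta_conj_right_all L (Matrix.of fun i j : Fin 3 => if i.val + j.val + 1 = 3 then (1 : L) else 0) μ)) v).Δ γH (Quotient.out c) * classOrbitalIntegral mG₃ (Set.indicator {u : ((UnitaryGroup.cmDatum L 3 (Matrix.of fun i j : Fin 3 => if i.val + j.val + 1 = 3 then (1 : L) else 0)).Local v) | u ∈ cmLocalIntegralLevel L 3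 (Matrix.of fun i j : Fin 3 => if i.val + j.val + 1 = 3 then (1 : L) else 0) v ∧ (InLevel ϖ a (wMatrix L w hw u - 1) ∧ InLevel ϖ b ((wMatrix L w hw u - 1) * (wMatrix L w hw u - 1)))} (fun _ => (1 : ℂ))) c =
          ((fun s : Fin 2 => if ((s : Fin 2) : ℕ) = d % 2 then (cA + cB) / (2 * (νH.real (Function.support (hFamily L w hw ϖ s)) : ℂ)) else -cB / (2 * (νH.real (Function.support (hFamily L w hw ϖ s)) : ℂ))) 0 * (νH.real (Function.support (hFamily L w hw ϖ 0)) : ℂ) + (fun s : Fin 2 => if ((s : Fin 2) : ℕ) = d % 2 then (cA + cB) / (2 * (νH.real (Function.support (hFamily L w hw ϖ s)) : ℂ)) else -cB / (2 * (νH.real (Function.support (hFamily L w hw ϖ s)) : ℂ))) 1 * (νH.real (Function.support (hFamily L w hw ϖ 1)) : ℂ)) * X + ((fun s : Fin 2 => if ((s : Fin 2) : ℕ) = d % 2 then (cA + cB) / (2 * (νH.real (Function.support (hFamily L w hw ϖ s)) : ℂ)) else -cB / (2 * (νH.real (Function.support (hFamily L w hw ϖ s)) : ℂ))) 0 * (if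 ((0 : Fin 2) : ℕ) = d % 2 then (0 : ℂ) else -2 * (νH.real (Function.support (hFamily L w hw ϖ 0)) : ℂ)) + (fun s : Fin 2 => if ((s : Fin 2) : ℕ) = d % 2 then (cA + cB) / (2 * (νH.real (Function.support (hFamily L w hw ϖ s)) : ℂ)) else -cB / (2 * (νH.real (Function.support (hFamily L w hw ϖ s)) : ℂ))) 1 * (if ((1 : Fin 2) : ℕ) = d % 2 then (0 : ℂ) else -2 * (νH.real (Function.support (hFamily L w hw ϖ 1)) : ℂ))) / 2 := by
  obtain ⟨VT, hVT, hT⟩ := Literature.NumberTheory.Rogawski1990.exists_nhds_one_forall_tokens_finTau_mul_finWeylRatio_eq_anyPlace L v w hw μ hμω (Matrix.of fun i j : Fin 3 => if i.val + j.val + 1 = 3 then (1 : L) else 0)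
  obtain ⟨VB, hVB, hB⟩ := F0P3cDyRamHProfilesTypeTwoVertexCount.exists_nhds_vertexProfile_div_eq_natCard_fixedBy_add_mod_two L w hw he νH ϖ hϖ d tE hD mH hmH
  obtain ⟨VL, hVL, hL⟩ := finsum_delta_mul_classOrbitalIntegral_levels_eq_literals L w hw he ϖ hϖ d tE hD μ νG₃ mG₃ hmG a b
  obtain ⟨VX, hVX, hXl⟩ := hLaw
  refine ⟨VT ∩ VB ∩ (VL ∩ VX), Filter.inter_mem (Filter.inter_mem hVT hVB) (Filter.inter_mem hVL hVX), fun γH hγ hreg hirr X hX => ?_⟩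
  obtain ⟨⟨hγT, hγB⟩, hγL, hγX⟩ := hγ
  have hν0 : (νH.real (Function.support (hFamily L w hw ϖ 0)) : ℂ) ≠ 0 := measureReal_support_hFamily_ne_zero L w hw he ϖ hϖ νH 0
  have hν1 : (νH.real (Function.support (hFamily L w hw ϖ 1)) : ℂ) ≠ 0 := measureReal_support_hFamily_ne_zero L w hw he ϖ hϖ νH 1
  -- the tokens and the scalar `τ·D = (β,θ)_v·q_v^{−m}`
  obtain ⟨m, β, hmt, hβ, hτ⟩ := hT γH hγT hreg
  -- the two literals and the census difference (★ p859549)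
  obtain ⟨th, ta, P₁, dg, η, γ₁, hth, hκh, hta, hκa, h1, h2, h3, h4, h5, h6, h7, h8, h9, h10, hsum⟩ := hL γH hγL hreg hirr
  -- `X` is the vertex count `NV` (★ p856225 at `s_V`, `ν_{s_V} ≠ 0`)
  have hb' := hB γH hγB hreg hirr
  have hXNV : X = ((Nat.card (MulAction.fixedBy (((UnitaryGroup.cmDatum L 2 (Matrix.of fun i j : Fin 2 => if i.val + j.val + 1 = 2 then (1 : L) else 0)).Local v) ⧸ cmLocalIntegralLevel L 2 (Matrix.of fun i j : Fin 2 => if i.val + j.val + 1 = 2 then (1 : L) else 0) v) γH.1) : ℂ) + ((d % 2 : ℕ) : ℂ)) := by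
    rw [← hb']
    rcases Nat.mod_two_eq_zero_or_one d with hd | hd
    · have hd' : ¬ d % 2 = 1 := by omega
      have h0 : ((0 : Fin 2) : ℕ) = d % 2 := by simp [hd]
      rw [if_neg hd', hX 0, if_pos h0, zero_div, add_zero, mul_comm, mul_div_cancel_right₀ X hν0]
    · have h1' : ((1 : Fin 2) : ℕ) = d % 2 := by simp [hd]
      rw [if_pos hd, hX 1, if_pos h1', zero_div, add_zero, mul_comm, mul_div_cancel_right₀ X hν1]
  -- the law at `(t_h, t_a, m, β)`
  have hlaw := hXl γH hγX hreg hirr th ta P₁ dg η γ₁ hth hκh hta hκa h1 h2 h3 h4 h5 h6 h7 h8 h9 h10 m β hmt hβ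
  rw [hsum, hτ th hth (Or.inl hκh), hlaw, hXNV]
  -- the coefAffine arithmetic (`ν_s ≠ 0`)
  rcases Nat.mod_two_eq_zero_or_one d with hd | hd
  · have h0 : ((0 : Fin 2) : ℕ) = d % 2 := by simp [hd]
    have h1' : ¬ ((1 : Fin 2) : ℕ) = d % 2 := by simp [hd]
    simp only [if_pos h0, if_neg h1']
    field_simp
    ring
  · have h0 : ¬ ((0 : Fin 2) : ℕ) = d % 2 := by simp [hd]
    have h1' : ((1 : Fin 2) : ℕ) = d % 2 := by simp [hd]
    simp only [if_neg h0, if_pos h1']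
    field_simp
    ring

end Summit.HodgeConjecture.HodgeConjecture.Cruxes.H413.F0P3cDyRamLevelsTypeTwoXOfCensusLaw

end
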